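import Summits.CriticalPhenomena.PercolationContinuityZ3.Theorems.Transplant.PlanarSkeletonFrmScaledDefs
import Summits.CriticalPhenomena.PercolationContinuityZ3.Theorems.Transplant.PlanarSkeletonFrmRayEsc
import HarnessLib

/-!
# Scaled Φ2 port, XV′: RAY ESCAPES for `PlanarSkeletonFrmScaled` — outward `N`-step maps on a big cylinder, rays of inner vertices with
# their tails, and the north/east disjointness rule (twin of `PlanarSkeletonFrmRayEsc`)

builds on p205010 (kernel theorem, internal audit signed; external expert review pending) — nothing in this file uses p205010; nothing here is a
claim about the open node `SamePDropOfSkeletonFrmScaled₁`.  Lane `prim-bschramm`, seat `prim-bschramm-p4` gen 16 (PART C3 of `P4-GENERAL.md` §38.5,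
HOME/prim-bschramm-p4-g16/SCALED-PHI2-PORT.md).  Helper file (`--supports stmt-CriticalPhenomena-4575 --as helper`).  No probability.

Differences from XV (unit interface): the step map moves the chart by `N eᵢ` (`Φ.step v i 1`); the big cylinder is `C_R(t)` for ANY `R ≥ ℓ + N`
(hypothesis `hR`, no upper bound is ever needed); the cylinder step `stpC` acts at INNER vertices (`φ − φ t ∈ Λ_ℓ`) only, identity elsewhere; ray
support positions are recorded by their chart OFFSET `j ≥ 1` (a multiple of `N`, but only `j ≥ 1` is used), so `ray_disjoint` / `north_cases` /
`cond_of_north` are VERBATIM; the ray of an inner vertex has `⌊(ℓ − (φᵢ x − φᵢ t))/N⌋ + 1 ≤ 2ℓ + 1` steps, lies in `Λ_{ℓ+N}`, ends outside `Λ_ℓ`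
with all other vertices inside, and its tails above the vertices of any set closed under `stpC 0, stpC 1` at inner vertices stay in the set.
[cite: KozmaNitzan2024, §4 p. 26 ((29))] [cite: AizenmanGrimmett1991, Thm 1 (essential enhancements)]
-/

noncomputable section

namespace Summit.CriticalPhenomena.PercolationContinuityZ3.Theorems.Transplant

namespace PlanarSkeletonFrmScaled

open SimpleGraph Walk Literature.Probability.LatticeModels
open scoped Classical

-- the scaled skeleton is called `Ψ` in this file (the statements are the scaled twins of XV's, over a different structure)
variable {V : Type} {G : SimpleGraph V} [G.LocallyFinite] (Ψ : PlanarSkeletonFrmScaled G)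

/-! ## §1 The outward `N`-step maps -/

/-- **A fixed outward `N`-step** in direction `eᵢ` (a choice from (ι_N)). [cite: KozmaNitzan2024, §4 p. 26 ((29))] -/
def stp (i : Fin 2) (v : V) : V := Classical.choose (Ψ.step v i 1)

/-- The step is along an edge. [folklore] -/
theorem adj_stp (i : Fin 2) (v : V) : G.Adj v (Ψ.stp i v) := (Classical.choose_spec (Ψ.step v i 1)).1

/-- The step moves the skeleton position by `N eᵢ`. [folklore] -/
theorem φ_stp (i : Fin 2) (v : V) : Ψ.φ (Ψ.stp i v) = Ψ.φ v + Pi.single i (Ψ.N : ℤ) := by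
  have h := (Classical.choose_spec (Ψ.step v i 1)).2
  rw [stp]
  simpa only [Units.val_one, mul_one] using h

/-- The moving coordinate increases by `N`. [folklore] -/
theorem φ_stp_same (i : Fin 2) (v : V) : Ψ.φ (Ψ.stp i v) i = Ψ.φ v i + Ψ.N := by
  rw [Ψ.φ_stp, Pi.add_apply, Pi.single_eq_same]

/-- The other coordinate is unchanged. [folklore] -/
theorem φ_stp_ne {i j : Fin 2} (h : j ≠ i) (v : V) : Ψ.φ (Ψ.stp i v) j = Ψ.φ v j := by
  rw [Ψ.φ_stp, Pi.add_apply, Pi.single_eq_of_ne h, add_zero]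

/-- Membership in a cylinder, coordinate-wise. [folklore] -/
theorem mem_cyl_two {t w : V} {L : ℕ} : w ∈ Ψ.cyl t L ↔ |Ψ.φ w 0 - Ψ.φ t 0| ≤ L ∧ |Ψ.φ w 1 - Ψ.φ t 1| ≤ L := by
  show Ψ.φ w - Ψ.φ t ∈ box 2 L ↔ _
  rw [PlanarSkeletonFrm.mem_box_two]; rfl

section Cyl

variable {t : V} {ℓ R : ℕ}

/-- **The step map on the big cylinder** `C_R(t)` (`R ≥ ℓ + N`): the outward `N`-step at INNER vertices (`φ − φ t ∈ Λ_ℓ`), the identity elsewhere.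
[folklore] -/
def stpC (t : V) (ℓ R : ℕ) (hR : ℓ + Ψ.N ≤ R) (i : Fin 2) (v : Ψ.cyl t R) : Ψ.cyl t R :=
  if h : Ψ.φ v.1 - Ψ.φ t ∈ box 2 ℓ then
    ⟨Ψ.stp i v.1, by
      have h2 := PlanarSkeletonFrm.mem_box_two.1 h
      simp only [Pi.sub_apply] at h2
      obtain ⟨h0, h1⟩ := h2
      rw [abs_le] at h0 h1
      have hR' : (ℓ : ℤ) + Ψ.N ≤ R := by exact_mod_cast hR
      rw [mem_cyl_two]
      constructor
      · by_cases hi : (0 : Fin 2) = i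
        · subst hi; rw [Ψ.φ_stp_same]; rw [abs_le]; constructor <;> linarith
        · rw [Ψ.φ_stp_ne hi]; rw [abs_le]; constructor <;> linarith
      · by_cases hi : (1 : Fin 2) = i
        · subst hi; rw [Ψ.φ_stp_same]; rw [abs_le]; constructor <;> linarith
        · rw [Ψ.φ_stp_ne hi]; rw [abs_le]; constructor <;> linarith⟩
  else v

/-- At an inner vertex the cylinder step is the step. [folklore] -/
theorem stpC_val (hR : ℓ + Ψ.N ≤ R) (i : Fin 2) {v : Ψ.cyl t R} (h : Ψ.φ v.1 - Ψ.φ t ∈ box 2 ℓ) :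
    (Ψ.stpC t ℓ R hR i v).1 = Ψ.stp i v.1 := by
  rw [stpC, dif_pos h]

/-- At an inner vertex the cylinder step is along an edge of the big cylinder graph. [folklore] -/
theorem adj_stpC (hR : ℓ + Ψ.N ≤ R) (i : Fin 2) {v : Ψ.cyl t R} (h : Ψ.φ v.1 - Ψ.φ t ∈ box 2 ℓ) :
    (G.induce (Ψ.cyl t R)).Adj v (Ψ.stpC t ℓ R hR i v) := by
  show G.Adj v.1 (Ψ.stpC t ℓ R hR i v).1
  rw [Ψ.stpC_val hR i h]; exact Ψ.adj_stp i v.1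

/-! ## §2 Ray walks -/

omit [G.LocallyFinite] in
/-- `cons` past a different start does not change `dropUntil`. [folklore] -/
theorem dropUntil_cons_ne' {W : Type} {H : SimpleGraph W} {a b c u : W} (h : H.Adj a b) (p : H.Walk b c)
    (hu : u ∈ p.support) (hne : a ≠ u) :
    (Walk.cons h p).dropUntil u (List.mem_cons_of_mem _ hu) = p.dropUntil u hu := by
  simp [Walk.dropUntil, hne]

/-- **THE RAY WALK** (`k` `N`-steps in direction `eᵢ` from `v`, all vertices but the last inner): a path of length `k` in the big cylinder graph from
`v` to `stpC^[k] v`; every support vertex is `v` or sits at `φ v + j eᵢ` with `1 ≤ j ≤ kN`; every support vertex is the last one or inner; and for every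
set `C` closed under both step maps at inner vertices, the tail of the walk above any of its `C`-vertices stays in `C`.
[cite: KozmaNitzan2024, §4 p. 26 ((29))] -/
theorem exists_rayWalk (hR : ℓ + Ψ.N ≤ R) (i : Fin 2) : ∀ (k : ℕ) (v : Ψ.cyl t R),
    (∀ j : Fin 2, j ≠ i → |Ψ.φ v.1 j - Ψ.φ t j| ≤ ℓ) → -(ℓ : ℤ) ≤ Ψ.φ v.1 i - Ψ.φ t i →
    (∀ j : ℕ, j < k → Ψ.φ v.1 i - Ψ.φ t i + j * Ψ.N ≤ (ℓ : ℤ)) →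
    ∃ W : (G.induce (Ψ.cyl t R)).Walk v ((Ψ.stpC t ℓ R hR i)^[k] v), W.IsPath ∧ W.length = k ∧
      Ψ.φ ((Ψ.stpC t ℓ R hR i)^[k] v).1 = Ψ.φ v.1 + Pi.single i ((k * Ψ.N : ℕ) : ℤ) ∧
      (∀ w ∈ W.support, w = v ∨ ∃ j : ℕ, 1 ≤ j ∧ j ≤ k * Ψ.N ∧ Ψ.φ w.1 = Ψ.φ v.1 + Pi.single i (j : ℤ)) ∧
      (∀ w ∈ W.support, w = (Ψ.stpC t ℓ R hR i)^[k] v ∨ Ψ.φ w.1 - Ψ.φ t ∈ box 2 ℓ) ∧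
      (∀ C : Set (Ψ.cyl t R), (∀ z ∈ C, Ψ.φ z.1 - Ψ.φ t ∈ box 2 ℓ → Ψ.stpC t ℓ R hR 0 z ∈ C ∧ Ψ.stpC t ℓ R hR 1 z ∈ C) →
        ∀ (u : Ψ.cyl t R) (hu : u ∈ W.support), u ∈ C → ∀ w ∈ (W.dropUntil u hu).support, w ∈ C) := by
  have hN1 : 1 ≤ Ψ.N := Ψ.one_le_N
  intro k
  induction k with
  | zero =>
    intro v _ _ _
    refine ⟨Walk.nil, Walk.IsPath.nil, rfl, by simp, fun w hw => Or.inl (by simpa using hw), fun w hw => Or.inl (by simpa using hw),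
      fun C _ u hu huC w hw => ?_⟩
    have huv : u = v := by simpa using hu
    subst huv
    rw [Walk.dropUntil_first] at hw
    simp only [Function.iterate_zero, id_eq, support_nil, List.mem_singleton] at hw
    exact hw ▸ huC
  | succ k ih =>
    intro v hoth hlo hhi
    -- `v` is inner
    have hvin : Ψ.φ v.1 - Ψ.φ t ∈ box 2 ℓ := by
      rw [mem_box]; intro j
      by_cases hj : j = i
      · subst hj; simp only [Pi.sub_apply]
        have h0 := hhi 0 (Nat.succ_pos k)
        push_cast at h0
        constructor <;> linarith
      · have := hoth j hj; rw [abs_le] at this; simpa only [Pi.sub_apply] using this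
    set v' : Ψ.cyl t R := Ψ.stpC t ℓ R hR i v with hv'
    have hv'1 : v'.1 = Ψ.stp i v.1 := Ψ.stpC_val hR i hvin
    have hφv'i : Ψ.φ v'.1 i = Ψ.φ v.1 i + Ψ.N := by rw [hv'1, Ψ.φ_stp_same]
    have hφv'j : ∀ j : Fin 2, j ≠ i → Ψ.φ v'.1 j = Ψ.φ v.1 j := fun j hj => by rw [hv'1, Ψ.φ_stp_ne hj]
    have hφv' : Ψ.φ v'.1 = Ψ.φ v.1 + Pi.single i (Ψ.N : ℤ) := by rw [hv'1, Ψ.φ_stp]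
    obtain ⟨W', hP', hlen', hend', hsup', hinn', htail'⟩ := ih v' (fun j hj => by rw [hφv'j j hj]; exact hoth j hj)
      (by rw [hφv'i]; linarith [show (0 : ℤ) ≤ (Ψ.N : ℤ) by positivity])
      (fun j hj => by
        rw [hφv'i]
        have h := hhi (j + 1) (by omega)
        push_cast at h ⊢
        linarith)
    have hadj : (G.induce (Ψ.cyl t R)).Adj v v' := Ψ.adj_stpC hR i hvin
    -- support positions of `W'` relative to `v`
    have hsupv : ∀ w ∈ W'.support, ∃ j : ℕ, 1 ≤ j ∧ j ≤ (k + 1) * Ψ.N ∧ Ψ.φ w.1 = Ψ.φ v.1 + Pi.single i (j : ℤ) := by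
      intro w hw
      rcases hsup' w hw with rfl | ⟨j, hj1, hjk, hφ⟩
      · refine ⟨Ψ.N, hN1, by nlinarith, by rw [hφv']⟩
      · refine ⟨j + Ψ.N, by omega, by nlinarith, ?_⟩
        rw [hφ, hφv', add_assoc, ← Pi.single_add]; push_cast; ring_nf
    have hvW' : v ∉ W'.support := by
      intro hv
      obtain ⟨j, hj1, -, hφ⟩ := hsupv v hv
      have := congrFun hφ i
      rw [Pi.add_apply, Pi.single_eq_same] at this
      omega
    refine ⟨Walk.cons hadj W', (cons_isPath_iff _ _).2 ⟨hP', hvW'⟩, by rw [length_cons]; exact congrArg (· + 1) hlen',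
      ?_, fun w hw => ?_, fun w hw => ?_, fun C hC u hu huC w hw => ?_⟩
    · show Ψ.φ ((Ψ.stpC t ℓ R hR i)^[k] v').1 = Ψ.φ v.1 + Pi.single i (((k + 1) * Ψ.N : ℕ) : ℤ)
      rw [hend', hφv', add_assoc, ← Pi.single_add]; push_cast; ring_nf
    · rw [support_cons, List.mem_cons] at hw
      rcases hw with rfl | hw
      · exact Or.inl rfl
      · exact Or.inr (hsupv w hw)
    · rw [support_cons, List.mem_cons] at hw
      rcases hw with rfl | hw
      · exact Or.inr hvin
      · exact hinn' w hw
    · by_cases huv : u = v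
      · subst huv
        rw [Walk.dropUntil_first, support_cons, List.mem_cons] at hw
        have hv'C : v' ∈ C := by
          have := hC u huC hvin
          fin_cases i
          · exact this.1
          · exact this.2
        rcases hw with rfl | hw
        · exact huC
        · have := htail' C hC v' W'.start_mem_support hv'C w
          rw [Walk.dropUntil_first] at this
          exact this hw
      · have hu' : u ∈ W'.support := by
          rw [support_cons, List.mem_cons] at hu
          exact hu.resolve_left huv
        have hw' : w ∈ (W'.dropUntil u hu').support := by
          simpa [Walk.dropUntil, Ne.symm huv] using hw
        exact htail' C hC u hu' huC w hw'

/-! ## §3 The ray of an inner vertex -/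

/-- Coordinates of a point at `φ a + j e₁`. [folklore] -/
theorem coords_one {a w : V} {j : ℕ} (h : Ψ.φ w = Ψ.φ a + Pi.single 1 (j : ℤ)) : Ψ.φ w 0 = Ψ.φ a 0 ∧ Ψ.φ w 1 = Ψ.φ a 1 + j := by
  constructor
  · rw [h, Pi.add_apply, Pi.single_eq_of_ne (by decide), add_zero]
  · rw [h, Pi.add_apply, Pi.single_eq_same]

/-- Coordinates of a point at `φ a + j e₀`. [folklore] -/
theorem coords_zero {a w : V} {j : ℕ} (h : Ψ.φ w = Ψ.φ a + Pi.single 0 (j : ℤ)) : Ψ.φ w 0 = Ψ.φ a 0 + j ∧ Ψ.φ w 1 = Ψ.φ a 1 := by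
  constructor
  · rw [h, Pi.add_apply, Pi.single_eq_same]
  · rw [h, Pi.add_apply, Pi.single_eq_of_ne (by decide), add_zero]

/-- **Number of `N`-steps of the ray** of `x` in direction `eᵢ` until it leaves `Λ_ℓ`: `⌊(ℓ − (φᵢ x − φᵢ t))/N⌋ + 1`. [folklore] -/
def rayLen (t : V) (ℓ : ℕ) (i : Fin 2) (x : Ψ.cyl t R) : ℕ := ((ℓ : ℤ) - (Ψ.φ x.1 i - Ψ.φ t i)).toNat / Ψ.N + 1

/-- **THE RAY of an inner vertex** `x` in direction `eᵢ` (`R ≥ ℓ + N`): a path in the big cylinder graph of length `≤ 2ℓ+1`, inside `Λ_{ℓ+N}`,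
ending OUTSIDE `Λ_ℓ`; its vertices other than `x` sit at `φ x + j eᵢ`, `j ≥ 1`; its other vertices are inner; its tails above vertices of a set closed
under the steps at inner vertices stay in the set, and the whole ray lies in any such set containing `x`. [cite: KozmaNitzan2024, §4 p. 26 ((29))] -/
theorem exists_rayC (hR : ℓ + Ψ.N ≤ R) (i : Fin 2) (x : Ψ.cyl t R) (hx : Ψ.φ x.1 - Ψ.φ t ∈ box 2 ℓ) :
    ∃ (p : Ψ.cyl t R) (W : (G.induce (Ψ.cyl t R)).Walk x p), W.IsPath ∧ W.length ≤ 2 * ℓ + 1 ∧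
      (∀ w ∈ W.support, w = x ∨ ∃ j : ℕ, 1 ≤ j ∧ Ψ.φ w.1 = Ψ.φ x.1 + Pi.single i (j : ℤ)) ∧
      (∀ w ∈ W.support, Ψ.φ w.1 - Ψ.φ t ∈ box 2 (ℓ + Ψ.N)) ∧
      Ψ.φ p.1 - Ψ.φ t ∉ box 2 ℓ ∧
      (∀ w ∈ W.support, w = p ∨ Ψ.φ w.1 - Ψ.φ t ∈ box 2 ℓ) ∧
      (∀ C : Set (Ψ.cyl t R), (∀ z ∈ C, Ψ.φ z.1 - Ψ.φ t ∈ box 2 ℓ → Ψ.stpC t ℓ R hR 0 z ∈ C ∧ Ψ.stpC t ℓ R hR 1 z ∈ C) →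
        ∀ (u : Ψ.cyl t R) (hu : u ∈ W.support), u ∈ C → ∀ w ∈ (W.dropUntil u hu).support, w ∈ C) ∧
      (∀ C : Set (Ψ.cyl t R), (∀ z ∈ C, Ψ.φ z.1 - Ψ.φ t ∈ box 2 ℓ → Ψ.stpC t ℓ R hR 0 z ∈ C ∧ Ψ.stpC t ℓ R hR 1 z ∈ C) →
        x ∈ C → ∀ w ∈ W.support, w ∈ C) := by
  have hN1 : 1 ≤ Ψ.N := Ψ.one_le_N
  have hx2 := mem_box.1 hx
  have hxi := hx2 i
  simp only [Pi.sub_apply] at hxi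
  -- the arithmetic of the number of steps: `a = ℓ − d`, `k = a / N + 1`
  set a : ℕ := ((ℓ : ℤ) - (Ψ.φ x.1 i - Ψ.φ t i)).toNat with ha
  have ha' : (a : ℤ) = (ℓ : ℤ) - (Ψ.φ x.1 i - Ψ.φ t i) := by rw [ha, Int.toNat_of_nonneg (by omega)]
  have hk : Ψ.rayLen t ℓ i x = a / Ψ.N + 1 := rfl
  have hdiv1 : a / Ψ.N * Ψ.N ≤ a := Nat.div_mul_le_self a Ψ.N
  have hdiv2 : a < a / Ψ.N * Ψ.N + Ψ.N := Nat.lt_div_mul_add (by omega)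
  have hdiv3 : a / Ψ.N ≤ a := Nat.div_le_self a Ψ.N
  obtain ⟨W, hP, hlen, hend, hsup, hinn, htail⟩ := Ψ.exists_rayWalk hR i (Ψ.rayLen t ℓ i x) x
    (fun j _ => by have := hx2 j; simp only [Pi.sub_apply] at this; exact abs_le.2 this) hxi.1
    (fun j hj => by
      rw [hk] at hj
      have hj' : j ≤ a / Ψ.N := by omega
      have hjN : j * Ψ.N ≤ a := (Nat.mul_le_mul_right _ hj').trans hdiv1
      have hjN' : ((j * Ψ.N : ℕ) : ℤ) ≤ a := by exact_mod_cast hjN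
      push_cast at hjN' ⊢
      linarith)
  refine ⟨_, W, hP, ?_, fun w hw => ?_, fun w hw => ?_, ?_, hinn, htail, fun C hC hxC w hw => ?_⟩
  · rw [hlen, hk]; omega
  · rcases hsup w hw with h | ⟨j, hj1, -, hφ⟩
    · exact Or.inl h
    · exact Or.inr ⟨j, hj1, hφ⟩
  · rcases hsup w hw with rfl | ⟨j, -, hjk, hφ⟩
    · rw [mem_box]; intro j'; have := hx2 j'; push_cast; constructor <;> linarith [this.1, this.2]
    · rw [mem_box]; intro j'
      simp only [Pi.sub_apply]
      by_cases hj' : j' = i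
      · subst hj'; rw [hφ, Pi.add_apply, Pi.single_eq_same]
        have hkN : Ψ.rayLen t ℓ j' x * Ψ.N ≤ a + Ψ.N := by rw [hk]; nlinarith
        have hjk' : (j : ℤ) ≤ a + Ψ.N := by exact_mod_cast hjk.trans hkN
        push_cast; constructor <;> linarith
      · rw [hφ, Pi.add_apply, Pi.single_eq_of_ne hj', add_zero]
        have := hx2 j'; simp only [Pi.sub_apply] at this; push_cast; constructor <;> linarith [this.1, this.2]
  · intro hin
    have := (mem_box.1 hin) i
    simp only [Pi.sub_apply] at this
    rw [hend, Pi.add_apply, Pi.single_eq_same] at this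
    have hkN : a < Ψ.rayLen t ℓ i x * Ψ.N := by rw [hk]; nlinarith
    have hkN' : (a : ℤ) < ((Ψ.rayLen t ℓ i x * Ψ.N : ℕ) : ℤ) := by exact_mod_cast hkN
    linarith [this.2]
  · have := htail C hC x W.start_mem_support hxC w
    rw [Walk.dropUntil_first] at this
    exact this hw

/-! ## §4 A north ray and an east ray are disjoint (verbatim from XV) -/

/-- **Disjointness of a NORTH ray (from `a`) and an EAST ray (from `b`)** under the coordinate condition. [folklore] -/
theorem ray_disjoint {a b w : Ψ.cyl t R}
    (h : Ψ.φ a.1 0 < Ψ.φ b.1 0 ∨ Ψ.φ b.1 1 < Ψ.φ a.1 1 ∨ (Ψ.φ a.1 = Ψ.φ b.1 ∧ a ≠ b))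
    (hwa : w = a ∨ ∃ j : ℕ, 1 ≤ j ∧ Ψ.φ w.1 = Ψ.φ a.1 + Pi.single 1 (j : ℤ))
    (hwb : w = b ∨ ∃ j : ℕ, 1 ≤ j ∧ Ψ.φ w.1 = Ψ.φ b.1 + Pi.single 0 (j : ℤ)) : False := by
  obtain ⟨ja, ha0, ha1, hja⟩ : ∃ ja : ℕ, Ψ.φ w.1 0 = Ψ.φ a.1 0 ∧ Ψ.φ w.1 1 = Ψ.φ a.1 1 + ja ∧ (w = a ∨ 1 ≤ ja) := by
    rcases hwa with rfl | ⟨j, hj, hφ⟩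
    · exact ⟨0, rfl, by simp, Or.inl rfl⟩
    · exact ⟨j, (Ψ.coords_one hφ).1, (Ψ.coords_one hφ).2, Or.inr hj⟩
  obtain ⟨jb, hb0, hb1, hjb⟩ : ∃ jb : ℕ, Ψ.φ w.1 0 = Ψ.φ b.1 0 + jb ∧ Ψ.φ w.1 1 = Ψ.φ b.1 1 ∧ (w = b ∨ 1 ≤ jb) := by
    rcases hwb with rfl | ⟨j, hj, hφ⟩
    · exact ⟨0, by simp, rfl, Or.inl rfl⟩
    · exact ⟨j, (Ψ.coords_zero hφ).1, (Ψ.coords_zero hφ).2, Or.inr hj⟩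
  rcases h with h | h | ⟨hφ, hab⟩
  · omega
  · omega
  · have h0 := congrFun hφ 0
    have h1 := congrFun hφ 1
    rcases hja with rfl | hja
    · rcases hjb with rfl | hjb
      · exact hab rfl
      · omega
    · omega

/-- **Who goes north** — one of the two orders of a pair satisfies "`φ₀ a < φ₀ b`, or `φ₀ a = φ₀ b` and `φ₁ b ≤ φ₁ a`". [folklore] -/
theorem north_cases (a b : V) :
    (Ψ.φ a 0 < Ψ.φ b 0 ∨ (Ψ.φ a 0 = Ψ.φ b 0 ∧ Ψ.φ b 1 ≤ Ψ.φ a 1)) ∨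
      (Ψ.φ b 0 < Ψ.φ a 0 ∨ (Ψ.φ b 0 = Ψ.φ a 0 ∧ Ψ.φ a 1 ≤ Ψ.φ b 1)) := by
  omega

/-- The rule with `a ≠ b` gives the disjointness condition for (north ray of `a`, east ray of `b`). [folklore] -/
theorem cond_of_north {a b : Ψ.cyl t R} (hab : a ≠ b)
    (h : Ψ.φ a.1 0 < Ψ.φ b.1 0 ∨ (Ψ.φ a.1 0 = Ψ.φ b.1 0 ∧ Ψ.φ b.1 1 ≤ Ψ.φ a.1 1)) :
    Ψ.φ a.1 0 < Ψ.φ b.1 0 ∨ Ψ.φ b.1 1 < Ψ.φ a.1 1 ∨ (Ψ.φ a.1 = Ψ.φ b.1 ∧ a ≠ b) := by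
  rcases h with h | ⟨h0, h1⟩
  · exact Or.inl h
  · rcases h1.lt_or_eq with h1 | h1
    · exact Or.inr (Or.inl h1)
    · refine Or.inr (Or.inr ⟨?_, hab⟩)
      ext j
      fin_cases j
      · exact h0
      · exact h1.symm

/-- For two distinct vertices there are directions `iA`, `iB` such that the `iA`-ray of the first and the `iB`-ray of the second are vertex-disjoint.
[folklore] -/
theorem exists_dirs (x y : Ψ.cyl t R) (hne : x ≠ y) : ∃ iA iB : Fin 2, ∀ w : Ψ.cyl t R,
    (w = x ∨ ∃ j : ℕ, 1 ≤ j ∧ Ψ.φ w.1 = Ψ.φ x.1 + Pi.single iA (j : ℤ)) →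
    (w = y ∨ ∃ j : ℕ, 1 ≤ j ∧ Ψ.φ w.1 = Ψ.φ y.1 + Pi.single iB (j : ℤ)) → False := by
  rcases Ψ.north_cases x.1 y.1 with h | h
  · exact ⟨1, 0, fun w hwa hwb => Ψ.ray_disjoint (Ψ.cond_of_north hne h) hwa hwb⟩
  · exact ⟨0, 1, fun w hwa hwb => Ψ.ray_disjoint (Ψ.cond_of_north hne.symm h) hwb hwa⟩

end Cyl

end PlanarSkeletonFrmScaled

end Summit.CriticalPhenomena.PercolationContinuityZ3.Theorems.Transplant

end
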